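import Summits.QuantumAdvantage.QuantumAdvantage.Theorems.SosSandwichPseudoBoundedClosure
import Mathlib.Data.Nat.Choose.Central

/-!
# Route `SosSandwich`, crux `PseudoBoundedAA` (stmt-QuantumAdvantage-15237) — CLT-free binomial window
bounds and the Hamming-weight counting layer (input of the Chebyshev-family calibration)

Helper (`--supports stmt-QuantumAdvantage-15237`), conjecture-free, no named facts. Generic, reusable
facts about the uniform cube measure needed by `SosSandwichPseudoBoundedAAChebyshevCalibration.lean`
(the `T`-side exponent calibration of `PseudoBoundedAA` through the Chebyshev family `T_k(ȳ)²`):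

* §1 BINOMIAL WINDOW BOUNDS (elementary, no Stirling / CLT): `16^n ≤ 4n·C(2n,n)²`
  (`sixteen_pow_le_centralBinom_sq`, i.e. `C(2n,n)/4^n ≥ 1/(2√n)`; induction with
  `(n+1)·C(2n+2,n+1) = 2(2n+1)·C(2n,n)` and `(2n+1)² ≥ 4n(n+1)`); `(n − t²)·C(2n,n) ≤ n·C(2n,n+t)`
  (`centralBinom_ratio_lower`, telescoping `C(2n,n+t+1)(n+t+1) = C(2n,n+t)(n−t)`); hence
  `(1 − c)²·16^n ≤ 4n·C(2n,n+t)²` whenever `t² ≤ c·n`, `c ≤ 1` (`sixteen_pow_le_choose_sq`): every weight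
  within `√(c·n)` of the centre carries probability `≥ (1 − c)/(2√n)`.
* §2 COUNTING LAYER: `#{x ∈ {0,1}^N : wt x = j} = C(N, j)` (`card_filter_weight_eq_choose`, bijection with
  `powersetCard`); `P[W] ≥ Σ_{j ∈ J} C(N,j)/2^N` whenever weights in `J` force `W`
  (`sum_choose_div_le_boolAvg`); the sign mean through the weight, `ȳ = (N − 2·wt)/N`
  (`signMeanVal_eq_weight`).

[folklore] (binomial coefficients; O'Donnell, Analysis of Boolean Functions, §1–§2 for the cube measure
[cite: ODonnell2014, §2.2]).
-/

set_option linter.dupNamespace false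

noncomputable section

namespace Summit.QuantumAdvantage.QuantumAdvantage.Theorems.SosSandwich

open Finset
open Literature.Computability.QuantumComplexity

variable {N : ℕ}

/-! ### §1 CLT-free binomial window bounds -/

/-- **Central binomial coefficient, square-root lower bound**: `16^n ≤ 4n · C(2n, n)²` (`n ≥ 1`), i.e.
`C(2n,n)/4^n ≥ 1/(2√n)`. Induction with `(n+1)·C(2n+2,n+1) = 2(2n+1)·C(2n,n)` and
`(2n+1)² ≥ 4n(n+1)`. [folklore] -/
theorem sixteen_pow_le_centralBinom_sq (n : ℕ) (hn : 1 ≤ n) :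
    (16 : ℝ) ^ n ≤ 4 * n * (Nat.centralBinom n : ℝ) ^ 2 := by
  induction n with
  | zero => omega
  | succ n ih =>
    rcases Nat.eq_zero_or_pos n with h0 | hpos
    · subst h0
      norm_num [Nat.centralBinom, Nat.choose]
    · have ih' := ih hpos
      have hrec : (((n + 1) * Nat.centralBinom (n + 1) : ℕ) : ℝ) =
          ((2 * (2 * n + 1) * Nat.centralBinom n : ℕ) : ℝ) := by
        exact_mod_cast Nat.succ_mul_centralBinom_succ n
      push_cast at hrec ⊢
      have hnr : (1 : ℝ) ≤ n := by exact_mod_cast hpos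
      set C := (Nat.centralBinom n : ℝ) with hCdef
      set D := (Nat.centralBinom (n + 1) : ℝ) with hDdef
      -- `(n+1) D = 2(2n+1) C`, `16^n ≤ 4 n C²`, `(2n+1)² ≥ 4n(n+1)`
      have h1 : ((n : ℝ) + 1) ^ 2 * D ^ 2 = 4 * (2 * n + 1) ^ 2 * C ^ 2 := by
        have : ((n : ℝ) + 1) * D = 2 * (2 * n + 1) * C := hrec
        calc ((n : ℝ) + 1) ^ 2 * D ^ 2 = (((n : ℝ) + 1) * D) ^ 2 := by ring
          _ = (2 * (2 * n + 1) * C) ^ 2 := by rw [this]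
          _ = 4 * (2 * n + 1) ^ 2 * C ^ 2 := by ring
      have h2 : (16 : ℝ) ^ n * 16 * (n + 1) ^ 2 ≤ 4 * (n + 1) * D ^ 2 * (n + 1) ^ 2 := by
        have h3 : (16 : ℝ) ^ n * 16 * (n + 1) ≤ 16 * (2 * n + 1) ^ 2 * C ^ 2 := by nlinarith [ih']
        nlinarith [h3, h1]
      have hpos2 : (0 : ℝ) < ((n : ℝ) + 1) ^ 2 := by positivity
      rw [pow_succ]
      exact le_of_mul_le_mul_right (by linarith [h2]) hpos2

/-- **Ratio bound near the centre**: `(n − t²) · C(2n, n) ≤ n · C(2n, n + t)` for all `n, t`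
(telescoping `C(2n, n+t+1)(n+t+1) = C(2n, n+t)(n−t)` and `(n−(t+1)²)(n+t+1) ≤ (n−t²)(n−t)`). [folklore] -/
theorem centralBinom_ratio_lower (n t : ℕ) :
    ((n : ℝ) - (t : ℝ) ^ 2) * ((2 * n).choose n : ℝ) ≤ n * ((2 * n).choose (n + t) : ℝ) := by
  induction t with
  | zero => simp
  | succ t ih =>
    have hcn : (0 : ℝ) ≤ (((2 * n).choose n : ℕ) : ℝ) := Nat.cast_nonneg _
    by_cases ht : t + 1 ≤ n
    · have htle : t ≤ n := by omega
      have hrec : (((2 * n).choose (n + t + 1) : ℕ) : ℝ) * ((n : ℝ) + t + 1) =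
          (((2 * n).choose (n + t) : ℕ) : ℝ) * ((n : ℝ) - t) := by
        have h := Nat.choose_succ_right_eq (2 * n) (n + t)
        have e : 2 * n - (n + t) = n - t := by omega
        rw [e] at h
        have h' : (((2 * n).choose (n + t + 1) * (n + t + 1) : ℕ) : ℝ) =
            (((2 * n).choose (n + t) * (n - t) : ℕ) : ℝ) := by exact_mod_cast h
        push_cast [Nat.cast_sub htle] at h'
        linarith [h']
      have hpos : (0 : ℝ) < (n : ℝ) + t + 1 := by positivity
      have hc0 : (0 : ℝ) ≤ (((2 * n).choose (n + t) : ℕ) : ℝ) := Nat.cast_nonneg _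
      have hnt : (0 : ℝ) ≤ (n : ℝ) - t := by
        have : (t : ℝ) ≤ n := by exact_mod_cast htle
        linarith
      push_cast
      rw [show n + (t + 1) = n + t + 1 by ring]
      set Ct1 := (((2 * n).choose (n + t + 1) : ℕ) : ℝ)
      set Ct := (((2 * n).choose (n + t) : ℕ) : ℝ)
      set C0 := (((2 * n).choose n : ℕ) : ℝ)
      -- from `ih`: `(n - t²) C0 (n - t) ≤ n Ct (n - t) = n Ct1 (n + t + 1)`
      have h1 : ((n : ℝ) - (t : ℝ) ^ 2) * C0 * ((n : ℝ) - t) ≤ n * Ct * ((n : ℝ) - t) :=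
        mul_le_mul_of_nonneg_right ih hnt
      have h2 : ((n : ℝ) - ((t : ℝ) + 1) ^ 2) * ((n : ℝ) + t + 1) ≤ ((n : ℝ) - (t : ℝ) ^ 2) * ((n : ℝ) - t) := by
        have ht0 : (0 : ℝ) ≤ t := Nat.cast_nonneg t
        nlinarith [sq_nonneg (t : ℝ), ht0]
      have h3 : ((n : ℝ) - ((t : ℝ) + 1) ^ 2) * ((n : ℝ) + t + 1) * C0 ≤
          ((n : ℝ) - (t : ℝ) ^ 2) * ((n : ℝ) - t) * C0 := mul_le_mul_of_nonneg_right h2 hcn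
      have h4 : (n : ℝ) * Ct * ((n : ℝ) - t) = n * Ct1 * ((n : ℝ) + t + 1) := by
        rw [mul_assoc, ← hrec]; ring
      -- divide by `n + t + 1 > 0`
      have h5 : ((n : ℝ) - ((t : ℝ) + 1) ^ 2) * C0 * ((n : ℝ) + t + 1) ≤ n * Ct1 * ((n : ℝ) + t + 1) := by
        nlinarith [h1, h3, h4]
      exact le_of_mul_le_mul_right h5 hpos
    · -- `n + t + 1 > 2n`: the coefficient vanishes and `n - (t+1)² < 0`
      have hz : (2 * n).choose (n + (t + 1)) = 0 := Nat.choose_eq_zero_of_lt (by omega)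
      rw [hz]
      push_cast
      have h1 : (n : ℝ) < (t : ℝ) + 1 := by exact_mod_cast (show n < t + 1 by omega)
      have ht0 : (0 : ℝ) ≤ t := Nat.cast_nonneg t
      have hn0 : (0 : ℝ) ≤ n := Nat.cast_nonneg n
      have : (n : ℝ) - ((t : ℝ) + 1) ^ 2 ≤ 0 := by nlinarith
      nlinarith [mul_nonneg hcn hn0]

/-- Near the centre, every binomial weight is comparable to the central one:
`t² ≤ c·n`, `0 ≤ c ≤ 1` ⟹ `C(2n, n+t)/4^n ≥ (1 − c)/(2√n)`, in the square form
`(1 − c)² · 16^n ≤ 4n · C(2n, n+t)²`. [folklore] -/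
theorem sixteen_pow_le_choose_sq (n t : ℕ) (hn : 1 ≤ n) {c : ℝ} (hc1 : c ≤ 1)
    (ht : (t : ℝ) ^ 2 ≤ c * n) :
    (1 - c) ^ 2 * (16 : ℝ) ^ n ≤ 4 * n * ((2 * n).choose (n + t) : ℝ) ^ 2 := by
  have hcen := sixteen_pow_le_centralBinom_sq n hn
  rw [Nat.centralBinom_eq_two_mul_choose] at hcen
  have hrat := centralBinom_ratio_lower n t
  have hnpos : (0 : ℝ) < n := by exact_mod_cast hn
  have hC0 : (0 : ℝ) ≤ (((2 * n).choose n : ℕ) : ℝ) := Nat.cast_nonneg _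
  -- `(1 - c) n C0 ≤ (n - t²) C0 ≤ n Ct`, so `(1 - c) C0 ≤ Ct`
  have h1 : (1 - c) * (((2 * n).choose n : ℕ) : ℝ) ≤ (((2 * n).choose (n + t) : ℕ) : ℝ) := by
    have h2 : (1 - c) * n * (((2 * n).choose n : ℕ) : ℝ) ≤ n * (((2 * n).choose (n + t) : ℕ) : ℝ) := by
      nlinarith [hrat, hC0]
    nlinarith [h2]
  have h1c : 0 ≤ 1 - c := by linarith
  have h3 : ((1 - c) * (((2 * n).choose n : ℕ) : ℝ)) ^ 2 ≤ (((2 * n).choose (n + t) : ℕ) : ℝ) ^ 2 :=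
    pow_le_pow_left₀ (mul_nonneg h1c hC0) h1 2
  nlinarith [h3, hcen, sq_nonneg (1 - c)]

/-! ### §2 Counting layer: Hamming-weight fibres of the cube -/

/-- The number of points of the cube with exactly `j` ones is `C(N, j)`. [folklore] -/
theorem card_filter_weight_eq_choose (N j : ℕ) :
    (Finset.univ.filter (fun x : Fin N → Bool =>
      (Finset.univ.filter (fun i => x i = true)).card = j)).card = N.choose j := by
  classical
  rw [show N.choose j = ((Finset.univ : Finset (Fin N)).powersetCard j).card by
    rw [Finset.card_powersetCard, Finset.card_univ, Fintype.card_fin]]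
  refine Finset.card_bij (fun x _ => Finset.univ.filter (fun i => x i = true)) ?_ ?_ ?_
  · intro x hx
    rw [Finset.mem_powersetCard]
    exact ⟨Finset.filter_subset _ _, (Finset.mem_filter.mp hx).2⟩
  · intro x _ y _ hxy
    funext i
    have h := congrArg (fun s : Finset (Fin N) => i ∈ s) hxy
    simp only [Finset.mem_filter, Finset.mem_univ, true_and, eq_iff_iff] at h
    cases hx' : x i <;> cases hy' : y i <;> simp_all
  · intro s hs
    refine ⟨fun i => decide (i ∈ s), ?_, ?_⟩
    · rw [Finset.mem_filter]
      refine ⟨Finset.mem_univ _, ?_⟩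
      rw [Finset.mem_powersetCard] at hs
      rw [← hs.2]
      congr 1; ext i; simp
    · ext i; simp

/-- **Window probabilities from binomial weights.** If every point whose Hamming weight lies in `J` satisfies
`W`, then `P[W] ≥ Σ_{j ∈ J} C(N, j)/2^N`. [folklore] -/
theorem sum_choose_div_le_boolAvg (W : (Fin N → Bool) → Prop) [DecidablePred W] (J : Finset ℕ)
    (hJ : ∀ x : Fin N → Bool, (Finset.univ.filter (fun i => x i = true)).card ∈ J → W x) :
    (∑ j ∈ J, (N.choose j : ℝ)) / (2 : ℝ) ^ N ≤ boolAvg (fun x => if W x then (1 : ℝ) else 0) := by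
  classical
  unfold boolAvg
  refine div_le_div_of_nonneg_right ?_ (by positivity)
  set wt : (Fin N → Bool) → ℕ := fun x => (Finset.univ.filter (fun i => x i = true)).card with hwt
  have hpt : ∀ x : Fin N → Bool, (if wt x ∈ J then (1 : ℝ) else 0) ≤ (if W x then (1 : ℝ) else 0) := by
    intro x
    by_cases h : wt x ∈ J
    · rw [if_pos h, if_pos (hJ x h)]
    · rw [if_neg h]; split_ifs <;> norm_num
  refine le_trans (le_of_eq ?_) (Finset.sum_le_sum fun x _ => hpt x)
  rw [Finset.sum_boole]
  have hfib := Finset.card_eq_sum_card_fiberwise (s := Finset.univ.filter (fun x : Fin N → Bool => wt x ∈ J))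
    (t := J) (f := wt) (fun x hx => (Finset.mem_filter.mp hx).2)
  rw [hfib]
  push_cast
  refine Finset.sum_congr rfl fun j hj => ?_
  rw [Finset.filter_filter]
  have : (Finset.univ.filter (fun x : Fin N → Bool => wt x ∈ J ∧ wt x = j)) =
      Finset.univ.filter (fun x : Fin N → Bool => wt x = j) := by
    ext x
    simp only [Finset.mem_filter, Finset.mem_univ, true_and]
    exact ⟨fun h => h.2, fun h => ⟨h ▸ hj, h⟩⟩
  rw [this, hwt, card_filter_weight_eq_choose]

/-- The sign mean through the Hamming weight: `(1/N)·Σᵢ (1 − 2xᵢ) = (N − 2·wt(x))/N`. [folklore] -/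
theorem signMeanVal_eq_weight (x : Fin N → Bool) :
    (1 / (N : ℝ)) * ∑ i, (1 - 2 * (if x i then (1 : ℝ) else 0)) =
      ((N : ℝ) - 2 * ((Finset.univ.filter (fun i => x i = true)).card : ℝ)) / N := by
  rw [Finset.sum_sub_distrib, Finset.sum_const, Finset.card_univ, Fintype.card_fin, ← Finset.mul_sum]
  have : ∑ i, (if x i then (1 : ℝ) else 0) = ((Finset.univ.filter (fun i => x i = true)).card : ℝ) := by
    rw [← Finset.sum_boole]
  rw [this]
  simp only [nsmul_eq_mul, mul_one]
  ring

end Summit.QuantumAdvantage.QuantumAdvantage.Theorems.SosSandwich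

end
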